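import Summits.CriticalPhenomena.PercolationContinuityZ3.Theorems.PercNearOneGluingNoHeavyLowerTailBlockQ9AnchoredDecomposition
import HarnessLib

/-!
# `NoHeavyLowerTail` (stmt-CriticalPhenomena-4575) — the TOURNAMENT CERTIFICATE for Kozma–Nitzan's Question 9 on a
# glued one-layer block with THREE dangerous port pairs

Support file (hull-port / coupling seat `prim-hp-1` gen 10; `--supports stmt-CriticalPhenomena-4575`).
No definitions, no named facts, no sorries.  Memo `run/shared/lean/prim/prim-hp-1/HULLPORT-COUPLING.md` §51(e).

Three dangerous boundary pairs `e_j = s(p_j, q_j)` (`j : Fin 3`, `q_j ∈ O`, `p_j ∈ A ∖ O`, weights `ρ_j < 1`), all other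
boundary pairs dominating.  A TOURNAMENT CERTIFICATE consists of "coins" `x j k ∈ [0,1]` (`x j k + x k j = 1`: the probability
that `j` beats `k`), the three BOX components `r (some j)` = `w` with `e_j ↦ 1` and `e_k ↦` the weight of odds
`odds(ρ_k)·x j k` (`k ≠ j`), and the GLUED component `r none` = `w` with all three pairs `↦ 1`, anchored at a chosen `jc`.
Their masses `ρ_j Π_{k≠j}(1 − ρ_k + ρ_k x j k)` and `ρ₀ρ₁ρ₂·cyc` (`cyc = x01 x12 x20 + x10 x21 x02`, the probability that
the random tournament is cyclic) cover the law of the three pairs exactly (the anchor of a cell is the Condorcet winner among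
its open pairs; the cyclic event goes to `jc`).

* `BlockQ9.blockQ9_threeDangerous_of_tournament` — if the four components are VALID in the unglued graph
  (`μ_{r i}(a ↔ b) ≤ μ_{r i}(anchor_i ↔ b)`), then `BQ` — an instance of `BlockQ9.blockQ9_of_anchoredDecomposition`; the
  content of this file is the covering identity.  For two pairs this is the θ-certificate of `blockQ9_twoDangerous`; for
  three pairs the existence of valid coins is LEMMA T3 of the memo (open; 0 failures in 4 406 instances).
[cite: KozmaNitzan2024, Lemma 5 (p. 13), Thm. 4 (pp. 12–14), Question 9 (p. 36)]
-/

namespace Summit.CriticalPhenomena.PercolationContinuityZ3.Theorems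

open MeasureTheory Set
open Literature.Probability.LatticeModels
open Literature.Probability.Percolation

noncomputable section
open Classical

namespace BlockQ9

variable {n : ℕ}

/-- **Question 9 for a glued one-layer block with three dangerous pairs, from a tournament certificate.**  See the file
header for the data; `hval_box`/`hval_glued` are the four validity conditions, `hr_*` pin the anchored weights.
[cite: KozmaNitzan2024, Lemma 5 (p. 13), Thm. 4 (pp. 12–14), Question 9 (p. 36); this work (memo §51(e))] -/
theorem blockQ9_threeDangerous_of_tournament (w : Sym2 (Fin n) → unitInterval) (O A : Finset (Fin n))
    (a b : Fin n) (hOA : Disjoint O A) (haO : a ∉ O) (hbO : b ∉ O)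
    (hiso : ∀ x ∈ O, ∀ y : Fin n, y ∉ O → y ∉ A → w s(x, y) = 0)
    (p q : Fin 3 → Fin n) (hq : ∀ j, q j ∈ O) (hpA : ∀ j, p j ∈ A) (hpO : ∀ j, p j ∉ O)
    (hinj : Function.Injective fun j => s(p j, q j))
    (hlt : ∀ j, (w s(p j, q j) : ℝ) < 1)
    (hdom : ∀ v ∈ A, ∀ o ∈ O, w s(o, v) ≠ 0 → (∀ j, s(o, v) ≠ s(p j, q j)) →
      (prodBernoulli (fun e : Sym2 (Fin n) => if (∃ x ∈ e, x ∈ O) then 0 else w e)).real (openConn a b) ≤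
        (prodBernoulli (fun e : Sym2 (Fin n) => if (∃ x ∈ e, x ∈ O) then 0 else w e)).real (openConn v b))
    (x : Fin 3 → Fin 3 → ℝ) (hx0 : ∀ j k, 0 ≤ x j k) (hxsum : ∀ j k, j ≠ k → x j k + x k j = 1)
    (jc : Fin 3)
    (r : Option (Fin 3) → Sym2 (Fin n) → unitInterval)
    (hr_off : ∀ i f, (∀ j, f ≠ s(p j, q j)) → r i f = w f)
    (hr_glued : ∀ j, r none s(p j, q j) = 1)
    (hr_anchor : ∀ j, r (some j) s(p j, q j) = 1)
    (hr_coin : ∀ j k, j ≠ k → ((r (some j) s(p k, q k) : unitInterval) : ℝ) =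
      (w s(p k, q k) : ℝ) * x j k / (1 - (w s(p k, q k) : ℝ) + (w s(p k, q k) : ℝ) * x j k))
    (hval_box : ∀ j, (prodBernoulli (r (some j))).real (openConn a b) ≤
      (prodBernoulli (r (some j))).real (openConn (p j) b))
    (hval_glued : (prodBernoulli (r none)).real (openConn a b) ≤ (prodBernoulli (r none)).real (openConn (p jc) b)) :
    (prodBernoulli (fun e : Sym2 (Fin n) => if (∀ x ∈ e, x ∈ O) ∧ ¬ e.IsDiag then 1 else w e)).real
        (openConn a b ∩ ⋃ o ∈ O, ⋃ x ∈ A, openConn o x) ≤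
      (prodBernoulli (fun e : Sym2 (Fin n) => if (∀ x ∈ e, x ∈ O) ∧ ¬ e.IsDiag then 1 else w e)).real
        (⋃ o ∈ O, openConn o b) := by
  -- the dangerous pairs and their weights
  set e : Fin 3 → Sym2 (Fin n) := fun j => s(p j, q j) with he
  set F : Finset (Sym2 (Fin n)) := Finset.univ.image e with hF
  set ρ : Fin 3 → ℝ := fun j => (w (e j) : ℝ) with hρ
  have hρ0 : ∀ j, 0 ≤ ρ j := fun j => (w (e j)).2.1
  have hρ1 : ∀ j, ρ j < 1 := fun j => hlt j
  have hden : ∀ j k, 0 < 1 - ρ k + ρ k * x j k := fun j k => by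
    have := mul_nonneg (hρ0 k) (hx0 j k); linarith [hρ1 k]
  -- masses
  set c : Option (Fin 3) → ℝ := fun i => match i with
    | none => ρ 0 * ρ 1 * ρ 2 * (x 0 1 * x 1 2 * x 2 0 + x 1 0 * x 2 1 * x 0 2)
    | some j => ρ j * ((1 - ρ (j + 1) + ρ (j + 1) * x j (j + 1)) * (1 - ρ (j + 2) + ρ (j + 2) * x j (j + 2)))
    with hc
  -- anchors of the components
  set P : Option (Fin 3) → Fin n := fun i => match i with | none => p jc | some j => p j with hP
  set Q : Option (Fin 3) → Fin n := fun i => match i with | none => q jc | some j => q j with hQ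
  have heF : ∀ j, e j ∈ F := fun j => Finset.mem_image.2 ⟨j, Finset.mem_univ _, rfl⟩
  have hFform : ∀ f ∈ F, ∃ p' s₀ : Fin n, f = s(p', s₀) ∧ s₀ ∈ O ∧ p' ∈ A ∧ p' ∉ O := by
    intro f hf
    obtain ⟨j, -, rfl⟩ := Finset.mem_image.1 hf
    exact ⟨p j, q j, rfl, hq j, hpA j, hpO j⟩
  have hnotF : ∀ f, f ∉ F ↔ ∀ j, f ≠ s(p j, q j) := by
    intro f
    simp only [hF, Finset.mem_image, Finset.mem_univ, true_and, not_exists]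
    exact ⟨fun h j hfj => h j hfj.symm, fun h j hj => h j hj.symm⟩
  refine blockQ9_of_anchoredDecomposition w O A a b hOA haO hbO hiso F hFform ?_ Finset.univ P Q r c
    ?_ ?_ ?_ ?_ ?_ ?_ ?_ ?_
  · -- hdom
    intro v hv o ho hne hnot
    exact hdom v hv o ho hne ((hnotF _).1 hnot)
  · -- hmem
    rintro (_ | j) -
    · exact heF jc
    · exact heF j
  · rintro (_ | j) -
    · exact hq jc
    · exact hq j
  · rintro (_ | j) -
    · exact hpO jc
    · exact hpO j
  · rintro (_ | j) -
    · exact hr_glued jc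
    · exact hr_anchor j
  · intro i _ f hf
    exact hr_off i f ((hnotF f).1 hf)
  · -- nonnegativity of the masses
    rintro (_ | j) -
    · simp only [hc]
      have h01 := hx0 0 1; have h12 := hx0 1 2; have h20 := hx0 2 0
      have h10 := hx0 1 0; have h21 := hx0 2 1; have h02 := hx0 0 2
      have := hρ0 0; have := hρ0 1; have := hρ0 2
      positivity
    · simp only [hc]
      exact mul_nonneg (hρ0 j) (mul_nonneg (hden j (j + 1)).le (hden j (j + 2)).le)
  · rintro (_ | j) -
    · exact hval_glued
    · exact hval_box j
  · -- the covering identity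
    intro T hT hTne
    have hTsub : T ⊆ F := Finset.mem_powerset.1 hT
    -- products over F are products over Fin 3
    have hprod : ∀ g : Sym2 (Fin n) → ℝ, ∏ f ∈ F, g f = g (e 0) * g (e 1) * g (e 2) := by
      intro g
      rw [hF, Finset.prod_image (fun j _ k _ h => hinj h), Fin.prod_univ_three]
    -- real values of the weights on F
    have hw : ∀ j, ((w (e j) : unitInterval) : ℝ) = ρ j := fun j => rfl
    have hrg : ∀ j, ((r none (e j) : unitInterval) : ℝ) = 1 := fun j => by rw [hr_glued j]; rfl
    have hra : ∀ j, ((r (some j) (e j) : unitInterval) : ℝ) = 1 := fun j => by rw [hr_anchor j]; rfl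
    have hrc : ∀ j k, j ≠ k → ((r (some j) (e k) : unitInterval) : ℝ) = ρ k * x j k / (1 - ρ k + ρ k * x j k) :=
      fun j k hjk => hr_coin j k hjk
    have hx10 : x 1 0 = 1 - x 0 1 := by linarith [hxsum 0 1 (by decide)]
    have hx20 : x 2 0 = 1 - x 0 2 := by linarith [hxsum 0 2 (by decide)]
    have hx21 : x 2 1 = 1 - x 1 2 := by linarith [hxsum 1 2 (by decide)]
    have hd01 := (hden 0 1).ne'; have hd02 := (hden 0 2).ne'; have hd12 := (hden 1 2).ne'
    have hd10 := (hden 1 0).ne'; have hd20 := (hden 2 0).ne'; have hd21 := (hden 2 1).ne'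
    rw [Fintype.sum_option, Fin.sum_univ_three]
    simp only [hprod, hc]
    -- evaluate `Fin 3` successor arithmetic in the masses
    have e1 : ((0 : Fin 3) + 1) = 1 := rfl
    have e2 : ((0 : Fin 3) + 2) = 2 := rfl
    have e3 : ((1 : Fin 3) + 1) = 2 := rfl
    have e4 : ((1 : Fin 3) + 2) = 0 := rfl
    have e5 : ((2 : Fin 3) + 1) = 0 := rfl
    have e6 : ((2 : Fin 3) + 2) = 1 := rfl
    simp only [e1, e2, e3, e4, e5, e6]
    -- which pairs are in `T`
    have hcontra : ¬ (e 0 ∉ T ∧ e 1 ∉ T ∧ e 2 ∉ T) := by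
      rintro ⟨a0, a1, a2⟩
      obtain ⟨f, hf⟩ := hTne
      obtain ⟨j, -, rfl⟩ := Finset.mem_image.1 (hTsub hf)
      fin_cases j
      · exact a0 hf
      · exact a1 hf
      · exact a2 hf
    have hmemT : ∀ j, e j ∈ T ∨ e j ∉ T := fun j => Classical.em _
    rcases hmemT 0 with h0 | h0 <;> rcases hmemT 1 with h1 | h1 <;> rcases hmemT 2 with h2 | h2
    all_goals first
      | (exfalso; exact hcontra ⟨h0, h1, h2⟩)
      | (simp only [h0, h1, h2, if_true, if_false, hw, hrg, hra, hrc 0 1 (by decide), hrc 0 2 (by decide),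
          hrc 1 0 (by decide), hrc 1 2 (by decide), hrc 2 0 (by decide), hrc 2 1 (by decide)]
         field_simp
         (try simp only [hx10, hx20, hx21])
         ring)

end BlockQ9

end

end Summit.CriticalPhenomena.PercolationContinuityZ3.Theorems
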